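import Summits.Langlands.Langlands.Theses.ParityBlindBianchi
import Summits.Langlands.Langlands.Theses.GaloisWeightedBE
import Summits.Langlands.Langlands.Theorems.IcosahedralDescentLevel.Negative.DoorOfInhabited
import Literature.NumberTheory.Automorphic.CuspidalRepGL2Exists
import Literature.NumberTheory.Automorphic.GLnAdelicStructureProofs

/-!
# The crux `IcosahedralDescentLevel` (stmt-Langlands-15113) AS TYPED is, by name, the sibling route's
# rank-0 target `GaloisWeightedBE.StrongArtinIcosahedralQ` (stmt-Langlands-10841)

Status file of the line `Sketch` (lead prover, continuation seat c2; `--supports stmt-Langlands-15113`).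

The refuters and the leads c0/c1 have kernel-checked that the typed crux D′ — whose hypothesis binds
`∃ S₀ : Finset ℕ` with no side condition, so that `S₀ = {0}` voids every good place — is
`repaired ∧ door` (`Negative.icosahedralDescentLevel_iff_repaired_and_door`, p98657), that the repaired
conjunct D″ (`0 ∉ S₀`) holds modulo the tree's four Arthur–Clozel facts
(`icosahedralDescentLevel_repaired`, p111861), and that the door is all-parity icosahedral strong Artin
over `ℚ` granted bare cuspidal inhabitation (`iff_allParityArtin_of_inhabited`, p114504).

This file names the door.  All-parity icosahedral strong Artin over `ℚ` is ALREADY an item of the tree: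
the rank-0 TARGET `Summit.Langlands.Langlands.Theses.GaloisWeightedBE.StrongArtinIcosahedralQ`
(stmt-Langlands-10841, open; "even σ: open — not a single case known", Calegari 2023 §12), stated with
`IsIcosahedralType σ.toMonoidHom`, which unfolds (`projectiveImage`) to the crux's own clause
`Nonempty ((Matrix.ProjGenLinGroup.mk.comp σ.toMonoidHom).range ≃* alternatingGroup (Fin 5))`.  Hence:

* `icosahedralDescentLevel_of_strongArtinIcosahedralQ` — `StrongArtinIcosahedralQ → IcosahedralDescentLevel`
  with NO hypothesis: the conclusion of the typed crux for `ρ` is strong Artin for `ρ`; its uniform-family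
  hypothesis is not consumed.
* `strongArtinIcosahedralQ_of_icosahedralDescentLevel` — conversely, granted only the named fact
  `nonempty_cuspidalAutomorphicRepData_two` (Gelbart 1975, Thm. 7.11: cusp forms exist on `GL₂` over every
  number field; the compactness witness is the tree's theorem `isCompact_glFiniteIntegralLevel_holds`),
  `IcosahedralDescentLevel → StrongArtinIcosahedralQ` (the refuters' `Negative.allParity_of_descent_of_inhabited`:
  junk bad set `S₀ = {0}`, free 2-adic models, Steinitz).
* `icosahedralDescentLevel_iff_strongArtinIcosahedralQ` — so, granted that one named fact, the rank-5
  "theorem-sized uniform descent" crux of `ParityBlindBianchi` IS the open rank-0 target of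
  `GaloisWeightedBE`; and `evenIcosahedralStrongArtin_of_icosahedralDescentLevel` — it alone already yields
  this route's own rank-0 target `EvenIcosahedralStrongArtin` (stmt-Langlands-2903), the cruxes E1′, E2′, R′
  of `closes` being idle.

Consequently the typed item can close exactly when stmt-Langlands-10841 closes: it is misstated as filed
(the intended statement is D″, `∃ S₀, (0 : ℕ) ∉ S₀ ∧ …`, restatement package attached to the item by c1).
-/

-- `Summit.Langlands.Langlands.…`: the repeated path component is the tree's layout (D-0017).
set_option linter.dupNamespace false

noncomputable section

open scoped MatrixGroups NumberField
open NumberField IsDedekindDomain Field Filter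
open Literature.NumberTheory.Automorphic Literature.NumberTheory.GaloisRepresentations
open Summit.Langlands.Langlands.Theses.ParityBlindBianchi
open Summit.Langlands.Langlands.Theses.GaloisWeightedBE (StrongArtinIcosahedralQ)

namespace Summit.Langlands.Langlands.Theorems.IcosahedralDescentLevel

/-- `IsIcosahedralType σ.toMonoidHom` is literally the crux's projective-image clause
(`projectiveImage ρ = (Matrix.ProjGenLinGroup.mk.comp ρ).range`). [folklore] -/
theorem isIcosahedralType_iff (σ : FramedGaloisRep ℚ ℂ 2) :
    IsIcosahedralType σ.toMonoidHom ↔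
      Nonempty ((Matrix.ProjGenLinGroup.mk.comp σ.toMonoidHom).range ≃* alternatingGroup (Fin 5)) :=
  Iff.rfl

/-- **The sibling target implies the typed crux, unconditionally.**  All-parity icosahedral strong
Artin over `ℚ` (`GaloisWeightedBE.StrongArtinIcosahedralQ`, stmt-Langlands-10841) gives
`IcosahedralDescentLevel` AS TYPED: the conclusion of the crux for `ρ` is strong Artin (a.e.) for `ρ`,
and the crux's uniform-family hypothesis (2-adic models and compatible cuspidal `π_K` off `S₀` over the
2-split imaginary quadratic fields) is simply not used. [folklore] -/
theorem icosahedralDescentLevel_of_strongArtinIcosahedralQ (h : StrongArtinIcosahedralQ) :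
    IcosahedralDescentLevel :=
  fun _ι ρ hirr hA5 _ => h ρ hirr ((isIcosahedralType_iff ρ).mpr hA5)

/-- **The typed crux implies the sibling target, granted only that cusp forms exist on `GL₂`.**
With the named fact `nonempty_cuspidalAutomorphicRepData_two` (Gelbart 1975, Thm. 7.11) supplying
SOME cuspidal datum over each 2-split imaginary quadratic `K` (compactness witness: the tree's
theorem `isCompact_glFiniteIntegralLevel_holds 2 K`), `IcosahedralDescentLevel` AS TYPED yields
strong Artin (a.e.) for EVERY irreducible icosahedral `ρ/ℚ`, odd or even — the refuters'
`Negative.allParity_of_descent_of_inhabited` (junk bad set `S₀ = {0}`: no place is good, so the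
compatibility clause is vacuous; the 2-adic model is free; `ι` exists by Steinitz).
[cite: Gelbart1975, Thm. 7.11] -/
theorem strongArtinIcosahedralQ_of_icosahedralDescentLevel (hC : nonempty_cuspidalAutomorphicRepData_two)
    (hD : IcosahedralDescentLevel) : StrongArtinIcosahedralQ :=
  fun ρ hirr hA5 =>
    Negative.allParity_of_descent_of_inhabited hD
      (fun K _ _ _ _ _ => ⟨isCompact_glFiniteIntegralLevel_holds 2 K,
        hC K (isCompact_glFiniteIntegralLevel_holds 2 K)⟩)
      ρ hirr ((isIcosahedralType_iff ρ).mp hA5)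

/-- **Granted that cusp forms exist on `GL₂`, the typed crux IS the sibling route's open target.**
Modulo the single named fact `nonempty_cuspidalAutomorphicRepData_two` (Gelbart 1975, Thm. 7.11),
`ParityBlindBianchi.IcosahedralDescentLevel` (stmt-Langlands-15113, rank 5, billed "theorem-sized
uniform descent") is EQUIVALENT to `GaloisWeightedBE.StrongArtinIcosahedralQ` (stmt-Langlands-10841,
rank-0 target: strong Artin for every irreducible icosahedral `ρ : Γ_ℚ → GL₂(ℂ)`, whose even case is
open).  The typed item therefore closes exactly when stmt-Langlands-10841 does; the intended statement
is the repaired D″ (`∃ S₀, (0 : ℕ) ∉ S₀ ∧ …`), landed modulo F1–F4 as `icosahedralDescentLevel_repaired`.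
[cite: Gelbart1975, Thm. 7.11] -/
theorem icosahedralDescentLevel_iff_strongArtinIcosahedralQ
    (hC : nonempty_cuspidalAutomorphicRepData_two) :
    IcosahedralDescentLevel ↔ StrongArtinIcosahedralQ :=
  ⟨strongArtinIcosahedralQ_of_icosahedralDescentLevel hC, icosahedralDescentLevel_of_strongArtinIcosahedralQ⟩

/-- **Granted that cusp forms exist on `GL₂`, the typed crux ALONE gives this route's own target.**
`IcosahedralDescentLevel` AS TYPED implies `EvenIcosahedralStrongArtin` (stmt-Langlands-2903, the rank-0
target of `ParityBlindBianchi`) modulo `nonempty_cuspidalAutomorphicRepData_two` only — the evenness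
hypothesis and the three other cruxes E1′ `ResidualBianchiDoorLevel`, E2′
`TwoAdicBianchiProModularityLevel`, R′ `ArtinWeightRealisationLevel` of the deciding theorem `closes`
are idle (sharpens the refuter's `Negative.allParity_of_door_of_descent`, p90502, which still fed the
door with E1′). [cite: Gelbart1975, Thm. 7.11] -/
theorem evenIcosahedralStrongArtin_of_icosahedralDescentLevel
    (hC : nonempty_cuspidalAutomorphicRepData_two) (hD : IcosahedralDescentLevel) :
    EvenIcosahedralStrongArtin :=
  fun ρ hirr hA5 _heven =>
    (icosahedralDescentLevel_iff_strongArtinIcosahedralQ hC).mp hD ρ hirr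
      ((isIcosahedralType_iff ρ).mpr hA5)

end Summit.Langlands.Langlands.Theorems.IcosahedralDescentLevel

end
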